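import Summits.BirchSwinnertonDyer.Rank1Residual.Supersingular.KuriharaTwistRecordLevelKLValues
import Summits.BirchSwinnertonDyer.Rank1Residual.Supersingular.X7KuriharaKP3OfferShape
import Summits.BirchSwinnertonDyer.Rank1Residual.Supersingular.CountPointsFast
import HarnessLib

/-!
# Depth-`k` Kurihara number `≠ 0` at a PRIME level, read off the literal integer equation: the `hδ` binder of the rank-one
# depth-`k` consumers (additive-p3's `RankOneKimLevelKUnitRecordShape`) from a LANDED `CertifiedK` row + `validHasseK` rounding
# certificate + the engine's `L`-value enclosure — record shape (class-free)

Cell `b2b-bsdres`, supersingular family, prover A = unit `b2b-bsdres-x10b` (gen 13; X7 joint pair, A side).  Topic file; namespace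
`Summit.BirchSwinnertonDyer.Rank1Residual.Supersingular`.  ONE THEOREM (composition of tree theorems by name); no named fact, no definition,
nothing asserted about any curve, nothing booked.

HONEST FRAMING (run/shared/lean/b2b/bsd-rank1-residual/, verbatim in every file): the goal of the
cell is to DELETE the COMBINATION-SHAPED residual classes of the Birch–Swinnerton-Dyer formula for
ALL analytic-rank `≤ 1` elliptic curves over `ℚ` — "full BSD formula for every rank `≤ 1` curve in
class `C`" assembled STRICTLY from published theorems — so that the rank-`≤ 1` remainder becomes
exactly the CONSTRUCTION-SHAPED classes, which are TYPED (missing-input `Prop`s), NOT attempted.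
This is not "finishing BSD".

`kuriharaNumber_primeLevel_ne_zero_of_ainvs_of_certifiedK_of_LValueBall`: for the literal curve `[a₁,…,a₆]` (minimality as an instance
hypothesis), a landed depth-`k` record `r` (`CertifiedK`, ONE prime `ℓ = r.n`), a `RoundingCertifiedHasseK r.k` row `c` matching it, the
decidable side conditions (`r.p ∤ Δ` and the point count at `r.p` for good reduction; `ℓ ∤ Δ`, `ℓ ≡ 1 (mod p^k)`, `countPoints … ℓ = n_ℓ` with
`p^k ∣ n_ℓ` for `ℓ ∈ 𝒫_k`; `A = ℓ + 1 − n_ℓ − 2 = a_ℓ − 2`), surjectivity of `ρ̄_{E,p}` at `r.p` (per record: gen-21 surj certificate; irreducibility follows), a `ψ` surjective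
at `ℓ`, and the ENCLOSURE `hballL` of `D'·c_∞·re(A·L(E,1) + Σ_{j≠0} e_q(−jk)·τ(χ_j)·L_j(1))/(q·Ω⁺_f)` for the `q = p^k` bins ⟹
`kuriharaNumber D.f (p^k) ℓ ψ ≠ 0` (`CertifiedK.kuriharaNumber_ne_zero_of_LValueBall`, this gen).  This is exactly the `hδ` binder of
`X7RankOne/X8RankOne.bsdp_three_of_kim2025_OPEN_of_ainvs_of_kuriharaNumber_ne_zero_of_shaAn_unit` (additive-p3 gen 22) — cyclicity is
the consumer's business (cube test there), not needed for `δ̃ ≠ 0`.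

References: [Kim2022StructureSelmer] §1.2.2, §1.4.3; [MazurTateTeitelbaum1986Invent] §I.8; [CremonaAlgorithms1997] §2.8; [SilvermanAEC2009] VII.5;
[IrelandRosen1990] Prop. 5.1.2.
-/

set_option autoImplicit false

noncomputable section

open scoped Classical MatrixGroups ModularForm

open CongruenceSubgroup WeierstrassCurve Literature.NumberTheory.EllipticCurves
  Literature.NumberTheory.EllipticCurves.ModularForms
  Literature.NumberTheory.EllipticCurves.Rank1Residual
  Literature.NumberTheory.EllipticCurves.Rank1Residual.Typed
  Literature.NumberTheory.EllipticCurves.Rank1Residual.X11RankOneCertificates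
  Summit.BirchSwinnertonDyer.BirchSwinnertonDyer.Rank1Residual.IntModel
  Summit.BirchSwinnertonDyer.BirchSwinnertonDyer.Rank1Residual.X11RankOne
  Summit.BirchSwinnertonDyer.Rank1Residual.X11b
  Summit.BirchSwinnertonDyer.Rank1Residual.Additive
  Summit.BirchSwinnertonDyer.Rank1Residual.Supersingular.KuriharaTwist

namespace Summit.BirchSwinnertonDyer.Rank1Residual.Supersingular

/-- **Depth-`k` `δ̃_ℓ ≠ 0` AT A PRIME LEVEL FROM THE LITERAL EQUATION, a landed `CertifiedK` row, its `validHasseK` certificate and the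
`L`-value enclosure** (class-free record shape; see the module docstring for the hypothesis list).  Per pair; nothing booked.
[cite: Kim2022StructureSelmer, §1.2.2 (PDF p. 5) and §1.4.3 (PDF p. 7)] [cite: MazurTateTeitelbaum1986Invent, §I.8 (8.6)]
[cite: CremonaAlgorithms1997, §2.8 (2.8.8) (PDF p. 26)] [cite: SilvermanAEC2009, VII.1 Remark 1.1 and VII.5 Prop. 5.1(a)]
[cite: IrelandRosen1990, Prop. 5.1.2 and §8.1] -/
theorem kuriharaNumber_primeLevel_ne_zero_of_ainvs_of_certifiedK_of_LValueBall
    (a1 a2 a3 a4 a6 : ℤ) (hmin : (⟨a1, a2, a3, a4, a6⟩ : WeierstrassCurve ℚ).IsGloballyMinimal)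
    {rs : List TwistRecordK} (hrs : CertifiedK rs) {r : TwistRecordK} (hr : r ∈ rs) [Fact r.p.Prime]
    (hν : r.primes.length = 1) (hp2 : r.p ≠ 2)
    {cs : List RoundingCert} (hcs : RoundingCertifiedHasseK r.k cs) {c : RoundingCert} (hcc : c ∈ cs)
    (hcp : c.p = r.p) (hcn : c.n = r.n) (hcden : c.den = r.den) (hcbins : c.bins = r.bins) (hD' : 0 < c.dstar)
    -- good reduction at `r.p`
    (hpΔ : ¬ (r.p : ℤ) ∣ discOf [a1, a2, a3, a4, a6]) {np : ℕ} (hcnt : countPoints [a1, a2, a3, a4, a6] r.p = np)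
    (hap : (r.p : ℤ) ∣ (r.p : ℤ) + 1 - np)
    (hsurj : (⟨a1, a2, a3, a4, a6⟩ : WeierstrassCurve ℚ).HasSurjectiveModNGaloisRep r.p)
    -- the prime level `ℓ = r.n ∈ 𝒫_k`
    (ℓ : ℕ) [Fact ℓ.Prime] [NeZero r.n] (hrn : ℓ = r.n) (hℓp : ℓ ≠ r.p) (hℓ2 : ℓ ≠ 2)
    (hℓΔ : ¬ (ℓ : ℤ) ∣ discOf [a1, a2, a3, a4, a6]) (h1 : ℓ ≡ 1 [MOD r.p ^ r.k]) {nl : ℕ}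
    (hcl : countPoints [a1, a2, a3, a4, a6] ℓ = nl) (hd : r.p ^ r.k ∣ nl)
    {A : ℤ} (hA : A = (ℓ : ℤ) + 1 - nl - 2)
    {N : ℕ} [NeZero N] (D : ModularParametrizationData (⟨a1, a2, a3, a4, a6⟩ : WeierstrassCurve ℚ) N)
    (ψ : (ℓ' : ℕ) → (ZMod ℓ')ˣ →* Multiplicative (ZMod (r.p ^ r.k))) (hψ : Function.Surjective (ψ ℓ))
    (hballL : ∀ (L : ZMod (r.p ^ r.k) → ℂ → ℂ), (∀ j, j ≠ 0 → Differentiable ℂ (L j)) →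
      (∀ j, j ≠ 0 → ∀ s : ℂ, 2 < s.re → L j s = twistedLSeries D.f (binChar r.n ψ j)⁻¹ s) →
      ∀ k < r.p ^ r.k, ∃ mid rad : ℝ, rad ≤ (c.radNum : ℝ) / 10 ^ c.radExp ∧
        |mid - ((c.binsStar.getD k 0 : ℤ) : ℝ)| ≤ (c.marNum : ℝ) / 10 ^ c.marExp ∧
        |(c.dstar : ℝ) * ((r.components : ℝ) *
          (((A : ℂ) * (⟨a1, a2, a3, a4, a6⟩ : WeierstrassCurve ℚ).entireLFunction 1 +
            ∑ j ∈ (Finset.univ : Finset (ZMod (r.p ^ r.k))).erase 0,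
              ZMod.stdAddChar (-(j * (k : ZMod (r.p ^ r.k)))) *
                (gaussSum (binChar r.n ψ j) (ZMod.stdAddChar (N := r.n)) * L j 1)).re /
            ((r.p ^ r.k : ℕ) * plusPeriod D.f))) - mid| ≤ rad) :
    kuriharaNumber D.f (r.p ^ r.k) r.n ψ ≠ 0 := by
  have h0 : discOf [a1, a2, a3, a4, a6] ≠ 0 := fun h ↦ hpΔ (by rw [h]; exact dvd_zero _)
  haveI := isElliptic_of_discOf_ne_zero a1 a2 a3 a4 a6 h0
  haveI := hmin
  have hI : integralModelInt (⟨a1, a2, a3, a4, a6⟩ : WeierstrassCurve ℚ) = ⟨a1, a2, a3, a4, a6⟩ :=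
    integralModelInt_eq_of_map_eq _ (map_mk_int a1 a2 a3 a4 a6)
  have hNp := natCard_point_eq_of_countPoints a1 a2 a3 a4 a6 r.p hp2 hpΔ hcnt
  have hNl := natCard_point_eq_of_countPoints a1 a2 a3 a4 a6 ℓ hℓ2 hℓΔ hcl
  have hirr : (⟨a1, a2, a3, a4, a6⟩ : WeierstrassCurve ℚ).HasIrreducibleModPGaloisRep r.p :=
    hasIrreducibleModPGaloisRep_of_hasSurjectiveModNGaloisRep _ r.p hsurj
  have hgood : (⟨a1, a2, a3, a4, a6⟩ : WeierstrassCurve ℚ).HasGoodReductionAtPrime r.p :=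
    (goodSS_of_intModel r.p hI (by rw [intCurve_Δ]; exact hpΔ) hNp hap).1
  have hK : Kato.IsKolyvaginPrime (⟨a1, a2, a3, a4, a6⟩ : WeierstrassCurve ℚ) r.p r.k ℓ :=
    Additive.isKolyvaginPrime_of_intModel_of_card hI r.p r.k ℓ hℓp (by rw [intCurve_Δ]; exact hℓΔ) h1 hNl hd
  have hn : Kato.IsKolyvaginProduct (⟨a1, a2, a3, a4, a6⟩ : WeierstrassCurve ℚ) r.p r.k r.n := by
    rw [← hrn]; exact hK.isKolyvaginProduct
  have hν' : r.n.primeFactors.card = r.primes.length := by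
    rw [← hrn, (Fact.out : ℓ.Prime).primeFactors, Finset.card_singleton, hν]
  have hψ' : ∀ ℓ' ∈ r.n.primeFactors, Function.Surjective (ψ ℓ') := by
    intro ℓ' h'
    rw [← hrn, (Fact.out : ℓ.Prime).primeFactors, Finset.mem_singleton] at h'
    subst h'; exact hψ
  have hprod : (∏ ℓ' ∈ r.n.primeFactors,
      (((⟨a1, a2, a3, a4, a6⟩ : WeierstrassCurve ℚ).frobeniusTrace ℓ' : ℂ) - 2)) = (A : ℂ) := by
    rw [← hrn]; exact prod_primeFactors_frobeniusTrace_sub_two_eq_of_prime hI Fact.out hNl hA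
  refine CertifiedK.kuriharaNumber_ne_zero_of_LValueBall hrs hr hν' D.isNewformOf hp2 hirr hgood hn hcs hcc hcp hcn
    hcden hcbins hD' ψ hψ' ?_
  intro L hL hL' k hk
  obtain ⟨mid, rad, h1', h2', h3'⟩ := hballL L hL hL' k hk
  refine ⟨mid, rad, h1', h2', ?_⟩
  rw [hprod]
  exact h3'

end Summit.BirchSwinnertonDyer.Rank1Residual.Supersingular

end
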